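import Mathlib
import HarnessLib

/-!
# `k`-local Ising / HUBO objectives in spin variables: energy, exact minimum, certificate shapes, metrics

HONEST FRAMING (lane `pub-qadeq`): instance-level adjudication of specific advantage claims; no claim
about BQP vs BPP or the summit. This file is the typed OBJECTIVE and the two published METRICS used by
the experimental optimisation claims the lane adjudicates; it asserts nothing about any experiment.

The objective. Chandarana et al. (Kipu Quantum), arXiv:2505.08663v1 §II eq. (1)–(2): a higher-order
unconstrained binary optimisation (HUBO) cost `F(x) = Σ_k Σ_{(i₁…i_k) ∈ G_k} T_{i₁…i_k} x_{i₁}⋯x_{i_k}`,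
`x_i ∈ {0,1}`, becomes after `x_i = (1 − σᶻ_i)/2` a `p`-spin Hamiltonian
`H_p = Σ_i h_i σᶻ_i + Σ_{(m,n)} J_{mn} σᶻ_m σᶻ_n + Σ_{(p,q,r)} K_{pqr} σᶻ_p σᶻ_q σᶻ_r` "whose ground state is
the optimal solution of `F(x)`"; Tuziemski et al., Phys. Rev. Applied 25 (2026) (arXiv:2510.06337) benchmark
exactly these 3-local instances (their App. A.1 uses the substitution `s_i = 1 − 2x_i`). The 2-local,
field-free case is the Ising spin-glass energy of Barahona, J. Phys. A 15 (1982) 3241, §2, and of King et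
al., Nature 617 (2023) 61 (3D spin glasses, `H_I`).

Design: spins are Boolean-coded, `σ : Fin N → Bool`, with the `±1` value `spin σ i` (`true ↦ +1`,
`false ↦ −1`) — the same one-line coding as `LABS.spin` in `LowAutocorrelation.lean` (same directory) and
`spinSign` in `Barriers/HubbardSuperconductivity/SignProblemNPHard.lean`; it is restated here (definitionally the
same formula) only so that this file has no intra-library import. An instance is a `List` of weighted monomials
`(c, S)` with `c : ℤ` and `S : List (Fin N)` (lists, not finsets, so that instance files and `decide`
certificates evaluate by structural recursion; a repeated index contributes `s_i² = 1`, harmless). The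
energy is `E_I(σ) = Σ_{(c,S) ∈ I} c · ∏_{i ∈ S} s_i(σ)`; `minEnergy I` is its minimum over the `2^N`
configurations; `IsGroundState I σ` says `σ` attains it.

## Contents (all proved; no named facts)
* `monomial`, `energy`, `locality`, `absWeight`; `energy_append`, `energy_perm` (term order is
  irrelevant), `abs_energy_le_absWeight` / `neg_absWeight_le_energy` (the trivial bound `|E| ≤ Σ|c|`).
* Global spin-flip (`ℤ₂` gauge) symmetry: `monomial_not`, `energy_not_of_even` — an instance all of whose
  monomials have even degree (e.g. a field-free 2-local spin glass, King et al. 2023) has `E(¬σ) = E(σ)`,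
  so its ground states come in pairs [folklore; Barahona 1982 §2 works with `J_{ij} σ_i σ_j` only].
* `minEnergy`, `exists_energy_eq_minEnergy`, `minEnergy_le_energy`, `le_minEnergy_iff`, `minEnergy_eq_iff`
  (the shape of a kernel certificate "`minEnergy I = E`": a witness with energy `E` and `∀ σ, E ≤ E_I(σ)`),
  `minEnergy_append` (block lower bound `min I + min J ≤ min (I ++ J)`), `neg_absWeight_le_minEnergy`.
* `IsGroundState`, `isGroundState_iff`, `isGroundState_of_lowerBound`, `isGroundState_append_of` — how an
  exact classical solver's output is CERTIFIED: a witness configuration plus any proved lower bound it meets.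
* `bit`, `two_mul_bit_eq`, `prod_one_sub_spin_eq` — the `x_i = (1 − s_i)/2` dictionary between the `{0,1}`
  (HUBO) and `±1` (Ising) forms [cite: ChandaranaEtAl2025, §II (x_i = (1 − σᶻ_i)/2)]
  [cite: TuziemskiEtAl2026, App. A.1 (s_i = 1 − 2x_i)].
* Metrics: `approxRatio E E_GS = E/E_GS` [cite: ChandaranaEtAl2025, §III ("approximation ratio R = E/E_GS")]
  with `approxRatio_le_one_of_neg` / `approxRatio_eq_one_iff` (with NEGATIVE optimal energy, `R ≤ 1` for every
  feasible energy and `R = 1` iff optimal — the sign convention made explicit), and King et al.'s residual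
  energy density `ρ = (E − E₀)/(N J)` [cite: KingEtAl2023, eq. (13)] with `residualEnergyDensity_nonneg` and
  `residualEnergyDensity_sub` (a common error in the reference energy `E₀` shifts all dynamics equally and
  cancels in differences [cite: KingEtAl2023, Supplementary Information §II.C ("an error in ground state energy
  affects the computed residual energy for all dynamics equally")]).
* Two toy `decide` certificates (frustrated triangle; a 3-local instance with a field) showing the
  certificate shape evaluates in the kernel. Instances of experimental size are NOT decided here.

## References
* [ChandaranaEtAl2025] P. Chandarana et al., Runtime quantum advantage with digital quantum optimization,
  arXiv:2505.08663v1 (2025), §II eqs. (1)–(2), §III.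
* [TuziemskiEtAl2026] J. Tuziemski et al., Limits of quantum run-time advantage, Phys. Rev. Applied 25 (2026),
  doi:10.1103/gpsf-pn1x (arXiv:2510.06337), App. A.1.
* [KingEtAl2023] A. D. King et al., Quantum critical dynamics in a 5,000-qubit programmable spin glass,
  Nature 617 (2023) 61–66, eq. (13) and Supplementary Information §II.C.
* [Barahona1982] F. Barahona, On the computational complexity of Ising spin glass models, J. Phys. A 15
  (1982) 3241–3253, §2.
-/

namespace Literature.Combinatorics.Optimization

namespace LocalIsing

open Finset

variable {N : ℕ}

/-! ### Spins -/

/-- The `±1` value of a Boolean-coded spin: `true ↦ +1`, `false ↦ −1` (same coding as `LABS.spin`).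
[cite: ChandaranaEtAl2025, §II eq. (2) (σᶻ eigenvalues ±1)] -/
def spin (σ : Fin N → Bool) (i : Fin N) : ℤ := if σ i then 1 else -1

/-- `s_i(σ)² = 1`. [folklore] -/
theorem spin_sq (σ : Fin N → Bool) (i : Fin N) : spin σ i ^ 2 = 1 := by
  unfold spin; split <;> norm_num

/-- A Boolean-coded spin takes the values `±1`. [folklore] -/
theorem spin_eq_one_or (σ : Fin N → Bool) (i : Fin N) : spin σ i = 1 ∨ spin σ i = -1 := by
  unfold spin; split <;> simp

/-- `|s_i(σ)| = 1`. [folklore] -/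
theorem abs_spin (σ : Fin N → Bool) (i : Fin N) : |spin σ i| = 1 := by
  rcases spin_eq_one_or σ i with h | h <;> simp [h]

/-- Global spin flip negates every spin: `s_i(¬σ) = −s_i(σ)`. [folklore] -/
theorem spin_not (σ : Fin N → Bool) (i : Fin N) : spin (fun j => !σ j) i = -spin σ i := by
  unfold spin; cases h : σ i <;> simp [h]

/-! ### Instances, monomials, energy -/

/-- A `k`-local Ising / HUBO-in-spin-variables instance on `N` spins: a list of weighted monomials
`(c, S)` — integer coefficient `c` (a field `h_i`, coupling `J_{mn}`, 3-body `K_{pqr}`, …) and the list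
`S` of the spins in the monomial. [cite: ChandaranaEtAl2025, §II eq. (2)] -/
abbrev Instance (N : ℕ) := List (ℤ × List (Fin N))

/-- The spin monomial `∏_{i ∈ S} s_i(σ) ∈ {±1}`. [cite: ChandaranaEtAl2025, §II eq. (2)] -/
def monomial (σ : Fin N → Bool) (S : List (Fin N)) : ℤ :=
  (S.map (spin σ)).prod

/-- The energy `E_I(σ) = Σ_{(c,S) ∈ I} c · ∏_{i ∈ S} s_i(σ)` (the value of the `p`-spin Hamiltonian
`H_p` on the computational-basis state `σ`). [cite: ChandaranaEtAl2025, §II eq. (2)] -/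
def energy (I : Instance N) (σ : Fin N → Bool) : ℤ :=
  (I.map fun t => t.1 * monomial σ t.2).sum

/-- The locality `k` of an instance: the largest monomial degree (`d` in Chandarana et al.'s eq. (1);
`3` for their experiments). [cite: ChandaranaEtAl2025, §II ("We restrict d = 3")] -/
def locality (I : Instance N) : ℕ :=
  (I.map fun t => t.2.length).foldr max 0

/-- The total absolute weight `Σ_{(c,S) ∈ I} |c|`. [folklore] -/
def absWeight (I : Instance N) : ℤ :=
  (I.map fun t => |t.1|).sum

/-- The empty monomial is `1`. [folklore] -/
@[simp] theorem monomial_nil (σ : Fin N → Bool) : monomial σ [] = 1 := by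
  simp [monomial]

/-- `∏_{j ∈ i :: S} s_j = s_i · ∏_{j ∈ S} s_j`. [folklore] -/
@[simp] theorem monomial_cons (σ : Fin N → Bool) (i : Fin N) (S : List (Fin N)) :
    monomial σ (i :: S) = spin σ i * monomial σ S := by
  simp [monomial]

/-- `|∏_{i ∈ S} s_i(σ)| = 1`. [folklore] -/
theorem abs_monomial (σ : Fin N → Bool) (S : List (Fin N)) : |monomial σ S| = 1 := by
  induction S with
  | nil => simp
  | cons i S ih => rw [monomial_cons, abs_mul, abs_spin, ih, one_mul]

/-- `(∏_{i ∈ S} s_i(σ))² = 1`. [folklore] -/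
theorem monomial_sq (σ : Fin N → Bool) (S : List (Fin N)) : monomial σ S ^ 2 = 1 := by
  rw [← sq_abs, abs_monomial, one_pow]

/-- Global spin flip multiplies a degree-`|S|` monomial by `(−1)^{|S|}`. [folklore] -/
theorem monomial_not (σ : Fin N → Bool) (S : List (Fin N)) :
    monomial (fun j => !σ j) S = (-1) ^ S.length * monomial σ S := by
  induction S with
  | nil => simp
  | cons i S ih =>
      rw [monomial_cons, monomial_cons, ih, spin_not, List.length_cons, pow_succ]
      ring

/-- The empty instance has energy `0`. [folklore] -/
@[simp] theorem energy_nil (σ : Fin N → Bool) : energy ([] : Instance N) σ = 0 := by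
  simp [energy]

/-- `E_{t :: I}(σ) = c_t · ∏_{i ∈ S_t} s_i(σ) + E_I(σ)`. [folklore] -/
@[simp] theorem energy_cons (t : ℤ × List (Fin N)) (I : Instance N) (σ : Fin N → Bool) :
    energy (t :: I) σ = t.1 * monomial σ t.2 + energy I σ := by
  simp [energy]

/-- Energy is additive over concatenation of term lists (block decomposition). [folklore] -/
theorem energy_append (I J : Instance N) (σ : Fin N → Bool) :
    energy (I ++ J) σ = energy I σ + energy J σ := by
  simp [energy, List.map_append, List.sum_append]

/-- The order of the terms is irrelevant. [folklore] -/
theorem energy_perm {I J : Instance N} (h : I.Perm J) (σ : Fin N → Bool) :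
    energy I σ = energy J σ :=
  (h.map _).sum_eq

/-- The trivial bound `|E_I(σ)| ≤ Σ |c|`. [folklore] -/
theorem abs_energy_le_absWeight (I : Instance N) (σ : Fin N → Bool) :
    |energy I σ| ≤ absWeight I := by
  induction I with
  | nil => simp [absWeight]
  | cons t I ih =>
      rw [energy_cons]
      have hw : absWeight (t :: I) = |t.1| + absWeight I := by simp [absWeight]
      rw [hw]
      calc |t.1 * monomial σ t.2 + energy I σ|
          ≤ |t.1 * monomial σ t.2| + |energy I σ| := abs_add_le _ _
        _ = |t.1| + |energy I σ| := by rw [abs_mul, abs_monomial, mul_one]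
        _ ≤ |t.1| + absWeight I := add_le_add le_rfl ih

/-- `−Σ|c| ≤ E_I(σ)`. [folklore] -/
theorem neg_absWeight_le_energy (I : Instance N) (σ : Fin N → Bool) :
    -absWeight I ≤ energy I σ :=
  (abs_le.mp (abs_energy_le_absWeight I σ)).1

/-- `ℤ₂` (global spin-flip) symmetry: if every monomial of `I` has even degree — e.g. a field-free
2-local spin glass — then `E_I(¬σ) = E_I(σ)`. [folklore] [cite: Barahona1982, §2 (H = Σ J_{ij} σ_i σ_j)] -/
theorem energy_not_of_even (I : Instance N) (h : ∀ t ∈ I, Even t.2.length) (σ : Fin N → Bool) :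
    energy I (fun j => !σ j) = energy I σ := by
  induction I with
  | nil => simp
  | cons t I ih =>
      rw [energy_cons, energy_cons, monomial_not, (h t (by simp)).neg_one_pow, one_mul,
        ih fun u hu => h u (by simp [hu])]

/-! ### The exact minimum and the certificate shape -/

/-- The minimum energy `min_σ E_I(σ)` over all `2^N` spin configurations (the ground-state energy
of `H_p`; "whose ground state is the optimal solution of `F(x)`").
[cite: ChandaranaEtAl2025, §II (after eq. (2))] -/
def minEnergy (I : Instance N) : ℤ :=
  (univ : Finset (Fin N → Bool)).inf' ⟨fun _ => true, mem_univ _⟩ (energy I)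

/-- `minEnergy I` is attained. [folklore] -/
theorem exists_energy_eq_minEnergy (I : Instance N) : ∃ σ : Fin N → Bool, energy I σ = minEnergy I := by
  obtain ⟨σ, -, hσ⟩ := exists_mem_eq_inf' (s := (univ : Finset (Fin N → Bool)))
    ⟨fun _ => true, mem_univ _⟩ (energy I)
  exact ⟨σ, hσ.symm⟩

/-- `minEnergy I` is a lower bound. [folklore] -/
theorem minEnergy_le_energy (I : Instance N) (σ : Fin N → Bool) : minEnergy I ≤ energy I σ :=
  inf'_le _ (mem_univ σ)

/-- `E ≤ minEnergy I` iff `E` is a lower bound for every configuration. [folklore] -/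
theorem le_minEnergy_iff (I : Instance N) (E : ℤ) : E ≤ minEnergy I ↔ ∀ σ : Fin N → Bool, E ≤ energy I σ := by
  unfold minEnergy
  rw [Finset.le_inf'_iff]
  simp

/-- Certificate characterisation: `minEnergy I = E` iff some configuration has energy `E` and none has
less. [folklore] -/
theorem minEnergy_eq_iff (I : Instance N) (E : ℤ) :
    minEnergy I = E ↔ (∃ σ : Fin N → Bool, energy I σ = E) ∧ ∀ σ : Fin N → Bool, E ≤ energy I σ := by
  constructor
  · rintro rfl
    exact ⟨exists_energy_eq_minEnergy I, minEnergy_le_energy I⟩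
  · rintro ⟨⟨σ, hσ⟩, h⟩
    exact le_antisymm (hσ ▸ minEnergy_le_energy I σ) ((le_minEnergy_iff I E).2 h)

/-- Block lower bound: `min I + min J ≤ min (I ++ J)` — the minimum of a sum of term blocks is at least
the sum of the block minima. [folklore] -/
theorem minEnergy_append (I J : Instance N) : minEnergy I + minEnergy J ≤ minEnergy (I ++ J) := by
  rw [le_minEnergy_iff]
  intro σ
  rw [energy_append]
  exact add_le_add (minEnergy_le_energy I σ) (minEnergy_le_energy J σ)

/-- `−Σ|c| ≤ minEnergy I`. [folklore] -/
theorem neg_absWeight_le_minEnergy (I : Instance N) : -absWeight I ≤ minEnergy I :=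
  (le_minEnergy_iff I _).2 (neg_absWeight_le_energy I)

/-- `σ` is a ground state (an optimal solution) of `I`. [cite: ChandaranaEtAl2025, §II (after eq. (2))] -/
def IsGroundState (I : Instance N) (σ : Fin N → Bool) : Prop :=
  ∀ τ : Fin N → Bool, energy I σ ≤ energy I τ

/-- `σ` is a ground state iff its energy is the minimum energy. [folklore] -/
theorem isGroundState_iff (I : Instance N) (σ : Fin N → Bool) :
    IsGroundState I σ ↔ energy I σ = minEnergy I := by
  constructor
  · intro h
    exact le_antisymm ((le_minEnergy_iff I _).2 h) (minEnergy_le_energy I σ)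
  · intro h τ
    exact h ▸ minEnergy_le_energy I τ

/-- How an exact solver's output is certified: a configuration whose energy meets ANY proved lower bound
is a ground state. [folklore] -/
theorem isGroundState_of_lowerBound {I : Instance N} {σ : Fin N → Bool} {L : ℤ}
    (hL : ∀ τ : Fin N → Bool, L ≤ energy I τ) (h : energy I σ ≤ L) : IsGroundState I σ :=
  fun τ => h.trans (hL τ)

/-- Block certificate: lower bounds for the blocks `I` and `J` met by one configuration on `I ++ J`
certify a ground state of `I ++ J`. [folklore] -/
theorem isGroundState_append_of {I J : Instance N} {σ : Fin N → Bool} {L₁ L₂ : ℤ}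
    (h₁ : ∀ τ : Fin N → Bool, L₁ ≤ energy I τ) (h₂ : ∀ τ : Fin N → Bool, L₂ ≤ energy J τ)
    (h : energy (I ++ J) σ ≤ L₁ + L₂) : IsGroundState (I ++ J) σ :=
  isGroundState_of_lowerBound (fun τ => (energy_append I J τ).symm ▸ add_le_add (h₁ τ) (h₂ τ)) h

/-- Under the spin-flip symmetry ground states come in pairs. [folklore] -/
theorem isGroundState_not_of_even {I : Instance N} (h : ∀ t ∈ I, Even t.2.length) {σ : Fin N → Bool}
    (hσ : IsGroundState I σ) : IsGroundState I (fun j => !σ j) :=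
  fun τ => (energy_not_of_even I h σ).symm ▸ hσ τ

/-! ### The `{0,1}` (HUBO) ↔ `±1` (Ising) dictionary -/

/-- The binary variable `x_i = (1 − s_i)/2 ∈ {0,1}` (`s_i = +1 ↦ 0`, `s_i = −1 ↦ 1`).
[cite: ChandaranaEtAl2025, §II ("x_i = (1 − σᶻ_i)/2")] [cite: TuziemskiEtAl2026, App. A.1 ("s_i = 1 − 2x_i")] -/
def bit (σ : Fin N → Bool) (i : Fin N) : ℤ := if σ i then 0 else 1

/-- `2 x_i = 1 − s_i`. [cite: ChandaranaEtAl2025, §II] -/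
theorem two_mul_bit_eq (σ : Fin N → Bool) (i : Fin N) : 2 * bit σ i = 1 - spin σ i := by
  unfold bit spin; cases σ i <;> simp

/-- `s_i = 1 − 2 x_i`. [cite: TuziemskiEtAl2026, App. A.1] -/
theorem spin_eq_one_sub_two_mul_bit (σ : Fin N → Bool) (i : Fin N) : spin σ i = 1 - 2 * bit σ i := by
  rw [two_mul_bit_eq]; ring

/-- A HUBO monomial in the `x`'s is, up to the factor `2^k`, the product `∏ (1 − s_i)` — which expands
into spin monomials of degree `≤ k`; hence a degree-`d` HUBO is a `d`-local Ising instance.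
[cite: ChandaranaEtAl2025, §II (eq. (1) "takes the form of a p-spin glass Hamiltonian", eq. (2))] -/
theorem prod_one_sub_spin_eq (σ : Fin N → Bool) (S : List (Fin N)) :
    (S.map fun i => 1 - spin σ i).prod = 2 ^ S.length * (S.map (bit σ)).prod := by
  induction S with
  | nil => simp
  | cons i S ih =>
      rw [List.map_cons, List.prod_cons, ih, List.map_cons, List.prod_cons, List.length_cons, pow_succ,
        ← two_mul_bit_eq]
      ring

/-! ### Published metrics -/

/-- The approximation ratio `R = E / E_GS` of an obtained energy `E` against the optimal (or best
known) energy `E_GS`. [cite: ChandaranaEtAl2025, §III ("achieve an approximation ratio R = E/E_GS")] -/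
def approxRatio (E Egs : ℤ) : ℚ := (E : ℚ) / (Egs : ℚ)

/-- Sign convention made explicit: when the optimal energy is NEGATIVE (as for these spin-glass
instances), every feasible energy `E ≥ E_GS` has `R ≤ 1`. [folklore] -/
theorem approxRatio_le_one_of_neg {E Egs : ℤ} (hneg : Egs < 0) (h : Egs ≤ E) : approxRatio E Egs ≤ 1 := by
  unfold approxRatio
  have hq : (Egs : ℚ) < 0 := by exact_mod_cast hneg
  rw [div_le_one_of_neg hq]
  exact_mod_cast h

/-- … and `R = 1` iff the obtained energy is optimal. [folklore] -/
theorem approxRatio_eq_one_iff {E Egs : ℤ} (hne : Egs ≠ 0) : approxRatio E Egs = 1 ↔ E = Egs := by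
  unfold approxRatio
  have hq : (Egs : ℚ) ≠ 0 := by exact_mod_cast hne
  rw [div_eq_one_iff_eq hq]
  exact_mod_cast Iff.rfl

/-- With a POSITIVE reference energy the inequality flips (`R ≥ 1` for feasible `E ≥ E_GS`) — the reason the
convention must be stated with the sign of `E_GS`. [folklore] -/
theorem one_le_approxRatio_of_pos {E Egs : ℤ} (hpos : 0 < Egs) (h : Egs ≤ E) : 1 ≤ approxRatio E Egs := by
  unfold approxRatio
  have hq : (0 : ℚ) < Egs := by exact_mod_cast hpos
  rw [one_le_div hq]
  exact_mod_cast h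

/-- King et al.'s residual energy density `ρ = (E − E₀)/(N·J)` of an energy `E` against the ground-state
energy `E₀`, per spin and in units of the coupling scale `J`. [cite: KingEtAl2023, eq. (13)] -/
def residualEnergyDensity (E E₀ : ℤ) (n : ℕ) (J : ℚ) : ℚ := ((E : ℚ) - E₀) / (n * J)

/-- `ρ ≥ 0` whenever `E₀` is a genuine lower bound and `J ≥ 0`. [folklore] -/
theorem residualEnergyDensity_nonneg {E E₀ : ℤ} (h : E₀ ≤ E) (n : ℕ) {J : ℚ} (hJ : 0 ≤ J) :
    0 ≤ residualEnergyDensity E E₀ n J := by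
  unfold residualEnergyDensity
  apply div_nonneg
  · have : (E₀ : ℚ) ≤ E := by exact_mod_cast h
    linarith
  · positivity

/-- A (common) error in the reference energy shifts every dynamics' residual energy equally: differences
of residual energies do not depend on the reference. [cite: KingEtAl2023, Supplementary Information §II.C] -/
theorem residualEnergyDensity_sub (E₁ E₂ E₀ E₀' : ℤ) (n : ℕ) (J : ℚ) :
    residualEnergyDensity E₁ E₀ n J - residualEnergyDensity E₂ E₀ n J =
      residualEnergyDensity E₁ E₀' n J - residualEnergyDensity E₂ E₀' n J := by
  unfold residualEnergyDensity
  rw [← sub_div, ← sub_div]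
  ring_nf

/-! ### Toy kernel certificates (the certificate shape evaluates by `decide`; experimental sizes are
NOT decided here) -/

/-- The frustrated antiferromagnetic triangle `s₀s₁ + s₁s₂ + s₀s₂`. [folklore] -/
def triangle : Instance 3 := [(1, [0, 1]), (1, [1, 2]), (1, [0, 2])]

/-- Its minimum energy is `−1` (one bond is always frustrated). [folklore] -/
theorem minEnergy_triangle : minEnergy triangle = -1 :=
  (minEnergy_eq_iff triangle (-1)).2 ⟨⟨![true, true, false], by decide⟩, by decide⟩

/-- A 3-local instance with a field: `2 s₀s₁s₂ − s₀ − s₁s₃ + s₂s₃` on 4 spins. [folklore] -/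
def cubicToy : Instance 4 := [(2, [0, 1, 2]), (-1, [0]), (-1, [1, 3]), (1, [2, 3])]

/-- Its minimum energy is `−5`, attained at `s = (+,+,−,+)`. [folklore] -/
theorem minEnergy_cubicToy : minEnergy cubicToy = -5 :=
  (minEnergy_eq_iff cubicToy (-5)).2 ⟨⟨![true, true, false, true], by decide⟩, by decide⟩

/-- `cubicToy` is 3-local. [folklore] -/
example : locality cubicToy = 3 := by decide

end LocalIsing

end Literature.Combinatorics.Optimization
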